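/-
Copyright: pub-rosobs cell (Resolution Observatory), carver gen 45.  Companion file; statements OURS, in
the cell's polynomial weighted-centre model `W(f)`.  Instrument — NOT a resolution theorem.
-/
import Literature.AlgebraicGeometry.Resolution.WeightedCentreStepUmbrellaReplay
import HarnessLib

/-!
# A purely inseparable bent family in dimension four: `max W(x^q + h_{p,a,m}) = (p^a, (mp+1)p^{a−1}, (mp+1)p^{a−1})`

Companion to `WeightedCentreStepUmbrella` / `WeightedCentreStepUmbrellaReplay` (the umbrella `X_i^p + X_j^m X_l`,
`max W = (p, m+1, m+1)`) and `WeightedCentreVertexPreparation` (the vertex theorems).  Everything is stated in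
the tree's POLYNOMIAL weighted-centre model: `admissibleInvariants f` = the invariants `exps γ` of the centres
`(Ψ, γ)` — `Ψ` a `k`-algebra automorphism of `k[X]` fixing the origin, `γ ≥ 0` rational weights, `v_γ(Ψ⁻¹ f) ≥ 1`
(`IsCentreFor`) — compared in the truncated lexicographic order (`IsMaxInv`).  Instrument; NOT a resolution
theorem and NOT a statement about the invariant of [AbramovichTemkinWlodarczyk2024] on power series.

## The family (variables `(x; y1, y2, y3) = (X 0; X 1, X 2, X 3)`)

For an integer `p ≥ 2`, `a = b + 2 ≥ 2`, `m ≥ 1` and `q = p^{c+1}` with `q/p = p^c > D := (mp+1)p^{a−1}`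
(equivalently `q > p^a (mp+1)`), put `n := (mp+1)(p−1)p^{a−2}`, `ℓ := y1^p − y2^{mp} y3` and
* `Φ := y1^{p^a} − y2^{m p^a} y3^{p^{a−1}} + y1^{p^{a−1}} y2^n − y2^{n + m p^{a−1}} y3^{p^{a−2}}` (`bentFace`;
  `= ℓ^{p^{a−1}} + y2^n ℓ^{p^{a−2}}` in characteristic `p`, `bentFace_eq_factored`),
* `h := y3^{q/p} + Φ` (`bentH`), `F := x^q + h` (`bentF`),
* the BENT coordinate change `Ψ : y3 ↦ y3 + x^p` then `y1 ↦ y1 + x y2^m` (`bentShear`) and the weights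
  `γ = (0; p^{−a}, 1/D, 1/D)` (`bentWeights`; `x` free).

## Main statements

* `bentShear_symm_bentF` : in characteristic `p` (prime), `Ψ⁻¹ F = h` — the `𝔾_a`-symmetry `σ_x` of `ℓ` absorbs `x^q`.
* `isCentreFor_bent`, `bent_mem_admissibleInvariants` : `(Ψ, γ)` is a centre for `F`, invariant `(p^a, D, D)`;
  `not_isTTight_bent` : it is NOT `T`-tight (the term `x y2^m` of `Ψ⁻¹ y1` has split value `1/q + m/D < p^{−a}`).
* `monomialOrd_one_bentH`, `homogeneousComponent_bentH`, `hironakaDelta_bentH`, `deltaInitial_bentH`,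
  `hironakaTau_bentFace` : over EVERY field, `ord h = p^a`, `in h = y1^{p^a}`, `δ(h; x,y2,y3; y1) = D/p^a =
  (mp+1)/p ∉ ℕ`, `in_δ h = Φ`, `τ(Φ) = 3`.
* `isMaxInv_triple_of_forall_natCast_ne` : the reusable `(ν, M, M)` pattern — order `ν` with `in = X_i^ν`,
  `δ = M/ν ∉ ℕ`, `ν < M`, `τ(in_δ) ≥ 3` and `(ν, M, M) ∈ W(f)` ⇒ `max W(f) = (ν, M, M)`.
* `isMaxInv_bentH` (every field, every integer `p ≥ 2`), **`isMaxInv_bentF`** / `isMaxInv_bentF'` (characteristic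
  `p`): `max W(F) = max W(h) = (p^a, D, D)`; `isMaxInv_bent_2_2_1_16` : the smallest instance
  `x^16 + y3^8 + y1^4 + y2^4 y3^2 + y1^2 y2^3 + y2^5 y3` over `𝔽_2`-algebras that are fields, `max W = (4, 6, 6)`.

The maximal invariant of `F` is thus attained by a NON-SPLIT, non-`T`-tight centre (the cell's counterexample
to its own "θ = 1/q" conjecture, engine-1 gen 28, Theorems 1(a) and 2 there, found by census and certified by
two engines).  NOT typed here: that no maximal centre of `F` is `T`-tight (their Theorem 1(b)), and anything in
the power-series model.

## References

[cite: AbramovichTemkinWlodarczyk2024, Rem. 2.4.2 (p. 1568), §5.1 (p. 1575), Lemma 5.2.6 / 5.2.10 (p. 1577), Thm. 5.3.1 (2)–(3) (p. 1578)]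
(the weighted invariant and centre in characteristic zero) ·
[cite: CossartJannsenSaito2020, Def. 1.26 / Lemma 1.27, Def. 8.1–8.2 (pp. 117–118), Def. 8.15 / Thm. 8.16 (p. 121), Thm. 8.22 (a) (p. 124)]
(`δ`, `in_δ`, `τ`, vertex preparation) · [cite: Hauser2010, §C (p. 9), §D (p. 12)] (purely inseparable equations
`x^p + h`, kangaroo phenomena) · [cite: AbramovichQuekSchober2025, Thm. 3.5] (the invariant is a maximum over centres).
-/

noncomputable section

open MvPolynomial

namespace Literature.AlgebraicGeometry.Resolution.WeightedBlowup

variable {k : Type*} [Field k] {N : ℕ}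

/-! ## §0 Generic tools: invariance at algebra-valued points, coefficients of `in_δ`, and the
`(ν, νδ, νδ)` maximality pattern for non-integral `δ` -/

section Generic

/-- A vector of the invariance space of `{F}` is a direction of translation invariance of `F` at every
point WITH VALUES IN ANY `k`-ALGEBRA `A` (e.g. `A = k[T]`): `F(y + t w) = F(y)` for `y ∈ A^N`, `t ∈ A` — the
polynomial identity `F(Y + Tw) = F(Y)` specialised; over a finite field `k` this is strictly stronger than the
`k`-valued statement `aeval_eq_of_mem_invarianceSpace`. (derived here) [cite: CossartJannsenSaito2020, Def. 1.26 /
Lemma 1.27 (directrix as the space of translations leaving the form invariant)] -/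
theorem aeval_algebra_eq_of_mem_invarianceSpace {A : Type*} [CommRing A] [Algebra k A]
    {F : MvPolynomial (Fin N) k} {w : Fin N → k} (hw : w ∈ invarianceSpace k {F}) (y : Fin N → A) (t : A) :
    aeval (fun x => y x + algebraMap k A (w x) * t) F = aeval y F := by
  have h := (mem_invarianceSpace_iff k).1 hw F (Set.mem_singleton F)
  have := congrArg (aeval fun o : Option (Fin N) => o.elim t y) h
  rw [translate, ← AlgHom.comp_apply, comp_aeval, aeval_rename, aeval_rename] at this
  have e1 : ((fun o : Option (Fin N) =>
      (aeval fun o : Option (Fin N) => o.elim t y) (o.elim (X none) fun x => X (some x) + C (w x) * X none)) ∘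
        some) = fun x => y x + algebraMap k A (w x) * t := by
    funext x
    simp
  have e2 : ((fun o : Option (Fin N) => o.elim t y) ∘ some) = y := by
    funext x
    simp
  rw [e1, e2] at this
  exact this

/-- **Coefficients of the `δ`-initial form**: `in_δ(f)` is the projection of `f` onto the monomials `y^B u^A`
with `|B| ≤ ν` and `|A| = δ(ν − |B|)` (the `δ`-face). (derived here)
[cite: CossartJannsenSaito2020, Def. 8.2 (4) (p. 118) (in_δ)] -/
theorem coeff_deltaInitial (S : Finset (Fin N)) (ν : ℕ) (δ : ℚ) (f : MvPolynomial (Fin N) k)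
    (d : Fin N →₀ ℕ) :
    coeff d (deltaInitial S ν δ f) =
      if blockDeg S d ≤ ν ∧ (coDeg S d : ℚ) = δ * ((ν - blockDeg S d : ℕ) : ℚ) then coeff d f else 0 := by
  classical
  unfold deltaInitial
  rw [coeff_sum]
  simp only [coeff_monomial]
  split_ifs with hP
  · by_cases hd : d ∈ f.support
    · rw [Finset.sum_eq_single d (fun b _ hbd => if_neg hbd)
        (fun hnot => absurd (Finset.mem_filter.2 ⟨hd, hP⟩) hnot), if_pos rfl]
    · rw [Finset.sum_eq_zero fun b hb => if_neg fun h : b = d => hd (h ▸ (Finset.mem_filter.1 hb).1)]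
      rw [mem_support_iff, not_not] at hd
      exact hd.symm
  · exact Finset.sum_eq_zero fun b hb => if_neg fun h : b = d => hP (h ▸ (Finset.mem_filter.1 hb).2)

/-- **Non-integral `δ` ⇒ `δ`-prepared for free**: a vertex on the `δ`-face would be a lattice point of degree
`δ`. (derived here) [cite: CossartJannsenSaito2020, Thm. 8.22 (a) (p. 124) (solvable vertices are integral),
Def. 8.15 (p. 121)] -/
theorem isDeltaPrepared_of_forall_natCast_ne {S : Finset (Fin N)} {ν : ℕ} {f : MvPolynomial (Fin N) k}
    {δ : ℚ} (hδ : hironakaDelta S ν f = (δ : WithTop ℚ)) (hδint : ∀ q : ℕ, (q : ℚ) ≠ δ) :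
    IsDeltaPrepared S ν f := by
  intro v _ hdeg
  exfalso
  rw [hδ, WithTop.coe_eq_coe] at hdeg
  exact hδint v.degree hdeg

/-- Every non-zero weight contributes its inverse to `exps` (plumbing). [folklore] -/
private theorem inv_mem_exps_of_ne_zero₄₅ {γ : Fin N → ℚ} {x : Fin N} (hx : γ x ≠ 0) :
    (γ x)⁻¹ ∈ exps γ := by
  classical
  unfold exps
  rw [List.mem_insertionSort, List.mem_map]
  exact ⟨x, Finset.mem_toList.2 (Finset.mem_filter.2 ⟨Finset.mem_univ _, hx⟩), rfl⟩

/-- The head of a sorted list is its minimum (plumbing). [folklore] -/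
private theorem le_of_mem_of_pairwise₄₅ {e x : ℚ} {es : List ℚ} (hs : (e :: es).Pairwise (· ≤ ·))
    (hx : x ∈ e :: es) : e ≤ x := by
  rcases List.mem_cons.1 hx with rfl | hx
  · exact le_rfl
  · exact (List.pairwise_cons.1 hs).1 x hx

/-- A sorted list with an entry `≤ θ` starts with one (plumbing). [folklore] -/
private theorem head_le_of_countP_pos₄₅ {θ e : ℚ} {es : List ℚ} (hs : (e :: es).Pairwise (· ≤ ·))
    (h : 0 < (e :: es).countP fun x => decide (x ≤ θ)) : e ≤ θ := by
  obtain ⟨x, hx, hxθ⟩ := List.countP_pos_iff.1 h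
  exact (le_of_mem_of_pairwise₄₅ hs hx).trans (by simpa using hxθ)

/-- Order bookkeeping for `[a, θ, θ]` (plumbing). [folklore] -/
private theorem not_lt_triple_of_snd_lt₄₅ {a θ e₂ : ℚ} {rest : List ℚ} (h : e₂ < θ) :
    ¬ ATW.TruncLex.lt [a, θ, θ] (a :: e₂ :: rest) := by
  rw [ATW.TruncLex.cons_lt_cons, ATW.TruncLex.cons_lt_cons]
  rintro (h1 | ⟨-, h2 | ⟨h3, -⟩⟩)
  · exact lt_irrefl _ h1
  · exact lt_asymm h h2
  · exact h.ne' h3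

/-- Order bookkeeping for `[a, θ, θ]` (plumbing). [folklore] -/
private theorem not_lt_triple_of_third_le₄₅ {a θ e₃ : ℚ} {rest : List ℚ} (h : e₃ ≤ θ) :
    ¬ ATW.TruncLex.lt [a, θ, θ] (a :: θ :: e₃ :: rest) := by
  rw [ATW.TruncLex.cons_lt_cons, ATW.TruncLex.cons_lt_cons, ATW.TruncLex.cons_lt_cons]
  rintro (h1 | ⟨-, h2 | ⟨-, h3 | ⟨-, h4⟩⟩⟩)
  · exact lt_irrefl _ h1
  · exact lt_irrefl _ h2
  · exact not_lt.2 h h3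
  · exact ATW.TruncLex.not_nil_lt _ h4

/-- Counting bookkeeping for the variables of weight `≥ 1/M` (plumbing). [folklore] -/
private theorem one_add_card_le_card_filter₄₅ {γ : Fin N → ℚ} {i : Fin N} {P M : ℚ} (hP : 0 < P)
    (hPM : P ≤ M) (hM : 0 < M) (hγi : γ i = P⁻¹) :
    1 + (Finset.univ.filter fun x => x ∉ ({i} : Finset (Fin N)) ∧ γ x = M⁻¹).card ≤
      (Finset.univ.filter fun x => γ x ≠ 0 ∧ (γ x)⁻¹ ≤ M).card := by
  rw [add_comm, ← Finset.card_insert_of_notMem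
    (s := Finset.univ.filter fun x => x ∉ ({i} : Finset (Fin N)) ∧ γ x = M⁻¹) (a := i) (by simp)]
  refine Finset.card_le_card fun x hx => ?_
  rw [Finset.mem_insert] at hx
  rw [Finset.mem_filter]
  refine ⟨Finset.mem_univ _, ?_⟩
  rcases hx with rfl | hx
  · rw [hγi, inv_inv]; exact ⟨inv_ne_zero hP.ne', hPM⟩
  · rw [Finset.mem_filter] at hx
    rw [hx.2.2, inv_inv]; exact ⟨inv_ne_zero hM.ne', le_rfl⟩

/-- **The `(ν, M, M)` pattern.**  Let `f` have order `ν` with initial form `X_i^ν` (so `τ = 1`, block `S = {i}`),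
`δ(f; u; X_i) = M/ν` NOT an integer (hence `f` is `δ`-prepared for free), `ν < M`, and `τ(in_δ f) ≥ 3`.  If
`(ν, M, M) ∈ W(f)` then **`max W(f) = (ν, M, M)`** over all admissible centres after all polynomial coordinate
changes: small weights give the prefix `(ν)` and, by the vertex theorem, a second entry `≤ νδ = M`; if it equals
`M`, the variable of weight `1/ν` is moved to `i` by a transposition and the non-integral count
(`hironakaTau_deltaInitial_le_of_forall_natCast_ne`, no twist possible) gives a third entry `≤ M`; a weight
`> 1/ν` gives a head `< ν`.  (The umbrella `X_i^p + X_j^m X_l` of `WeightedCentreStepUmbrella.isMaxInv_umbrella`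
is the case `f = in_δ f`; derived here as a reusable statement.)
[cite: CossartJannsenSaito2020, Thm. 8.16 (p. 121), Thm. 8.22 (a) (p. 124), Def. 8.2 (4) (p. 118)]
[cite: AbramovichTemkinWlodarczyk2024, Thm. 5.3.1 (2)–(3) (p. 1578)] [cite: AbramovichQuekSchober2025, Thm. 3.5] -/
theorem isMaxInv_triple_of_forall_natCast_ne {f : MvPolynomial (Fin N) k} {i : Fin N} {ν : ℕ} {M : ℚ}
    (hord : monomialOrd (fun _ => 1) f = ν) (hin : homogeneousComponent ν f = X i ^ ν) (hν : 0 < ν)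
    (hνM : (ν : ℚ) < M) (hδ : hironakaDelta {i} ν f = ((M / ν : ℚ) : WithTop ℚ))
    (hδint : ∀ q : ℕ, (q : ℚ) ≠ M / ν) (hτδ : 3 ≤ hironakaTau k {deltaInitial {i} ν (M / ν) f})
    (hmem : [(ν : ℚ), M, M] ∈ admissibleInvariants f) :
    IsMaxInv (admissibleInvariants f) [(ν : ℚ), M, M] := by
  classical
  have hpq : (0 : ℚ) < ν := by exact_mod_cast hν
  have hM0 : (0 : ℚ) < M := hpq.trans hνM
  have hpδ : (ν : ℚ) * (M / ν) = M := by field_simp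
  -- the inputs of the vertex theorems
  have hτ : ({i} : Finset (Fin N)).card = hironakaTau k {homogeneousComponent ν f} := by
    rw [hin, hironakaTau_X_pow i hν.ne', Finset.card_singleton]
  have hFS : ∀ d ∈ (homogeneousComponent ν f).support, ∀ x ∉ ({i} : Finset (Fin N)), d x = 0 := by
    intro d hd x hx
    rw [hin, X_pow_eq_monomial] at hd
    have hd' := Finset.mem_singleton.1 (support_monomial_subset hd)
    rw [Finset.mem_singleton] at hx
    rw [hd', Finsupp.single_apply, if_neg (Ne.symm hx)]
  have hprep : IsDeltaPrepared {i} ν f := isDeltaPrepared_of_forall_natCast_ne hδ hδint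
  refine ⟨hmem, ?_⟩
  rintro b ⟨Ψ, γ, h, rfl⟩
  have hsorted := exps_sorted γ
  have hγpos : ∀ x, γ x ≠ 0 → 0 < γ x := fun x hx => lt_of_le_of_ne (h.2.1 x) (Ne.symm hx)
  by_cases hle : ∀ x, γ x ≤ (ν : ℚ)⁻¹
  · -- `[ν]` is a prefix of `exps γ`, and at least two entries are `≤ M`
    obtain ⟨es, hes⟩ : ∃ es, exps γ = (ν : ℚ) :: es := by
      obtain ⟨t, ht⟩ := replicate_prefix_of_forall_le hord h hle
      rw [← hτ, Finset.card_singleton, List.replicate_one] at ht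
      exact ⟨t, ht.symm⟩
    have hcount := succ_card_le_countP_exps_of_isDeltaPrepared hord hτ hFS hprep hδ h hle
    rw [Finset.card_singleton, hpδ, hes, List.countP_cons_of_pos (by simpa using hνM.le)] at hcount
    rw [hes] at hsorted
    obtain ⟨e₂, es', rfl⟩ : ∃ e₂ es', es = e₂ :: es' := by
      cases es with
      | nil => simp at hcount
      | cons e₂ es' => exact ⟨e₂, es', rfl⟩
    have hs₂ : (e₂ :: es').Pairwise (· ≤ ·) := (List.pairwise_cons.1 hsorted).2
    have he₂ : e₂ ≤ M := head_le_of_countP_pos₄₅ hs₂ (by omega)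
    rw [hes]
    by_cases heq₂ : e₂ = M
    swap
    · exact not_lt_triple_of_snd_lt₄₅ (lt_of_le_of_ne he₂ heq₂)
    rw [heq₂] at hes hs₂ ⊢
    -- exactly one entry of `exps γ` is `≤ ν`: the variable `x₀` of weight `1/ν`
    have hes' : ∀ x ∈ es', M ≤ x := (List.pairwise_cons.1 hs₂).1
    have hcountp : (exps γ).countP (fun x => decide (x ≤ (ν : ℚ))) = 1 := by
      rw [hes, List.countP_cons_of_pos (by simp), List.countP_cons_of_neg (by simpa using hνM),
        List.countP_eq_zero.2 (fun x hx => by simpa using hνM.trans_le (hes' x hx))]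
    rw [countP_exps] at hcountp
    obtain ⟨x₀, hx₀⟩ := Finset.card_eq_one.1 hcountp
    have hx₀' : γ x₀ ≠ 0 ∧ (γ x₀)⁻¹ ≤ (ν : ℚ) := by
      have : x₀ ∈ ({x₀} : Finset (Fin N)) := Finset.mem_singleton_self x₀
      rw [← hx₀, Finset.mem_filter] at this
      exact this.2
    have hγx₀ : γ x₀ = (ν : ℚ)⁻¹ :=
      le_antisymm (hle x₀) (inv_le_of_inv_le₀ (hγpos x₀ hx₀'.1) hx₀'.2)
    have hothers : ∀ x, x ≠ x₀ → γ x ≤ M⁻¹ := by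
      intro x hx
      by_cases h0 : γ x = 0
      · rw [h0]; exact inv_nonneg.2 hM0.le
      have hnot : ¬ (γ x)⁻¹ ≤ (ν : ℚ) := by
        intro hle'
        apply hx
        have : x ∈ ({x₀} : Finset (Fin N)) := by
          rw [← hx₀, Finset.mem_filter]; exact ⟨Finset.mem_univ _, h0, hle'⟩
        exact Finset.mem_singleton.1 this
      have hmem' := inv_mem_exps_of_ne_zero₄₅ h0
      rw [hes, List.mem_cons] at hmem'
      rcases hmem' with heq | hmem'
      · exact absurd heq.le hnot
      · exact le_inv_of_le_inv₀ hM0 (le_of_mem_of_pairwise₄₅ hs₂ hmem')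
    -- move `x₀` to `i` and count the variables of weight exactly `1/M`
    set π : Equiv.Perm (Fin N) := Equiv.swap i x₀ with hπ
    have h' := h.perm π
    have hπi : π i = x₀ := Equiv.swap_apply_left i x₀
    have hπne : ∀ x, x ≠ i → π x ≠ x₀ := by
      intro x hx heq
      apply hx
      apply π.injective
      rw [heq, hπi]
    have hγS : ∀ x ∈ ({i} : Finset (Fin N)), (γ ∘ π) x = (ν : ℚ)⁻¹ := by
      intro x hx
      rw [Finset.mem_singleton] at hx
      rw [hx, Function.comp_apply, hπi, hγx₀]
    have hγle : ∀ x ∉ ({i} : Finset (Fin N)), (γ ∘ π) x ≤ ((ν : ℚ) * (M / ν))⁻¹ := by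
      intro x hx
      rw [Finset.mem_singleton] at hx
      rw [hpδ, Function.comp_apply]
      exact hothers _ (hπne x hx)
    have hbound := hironakaTau_deltaInitial_le_of_forall_natCast_ne hord hτ hFS hprep hδ hδint h' hγS hγle
    rw [Finset.card_singleton, hpδ] at hbound
    have hcnt : 3 ≤ (exps (γ ∘ π)).countP (fun x => decide (x ≤ M)) := by
      rw [countP_exps]
      exact (hτδ.trans hbound).trans (one_add_card_le_card_filter₄₅ hpq hνM.le hM0
        (by rw [Function.comp_apply, hπi, hγx₀]))
    rw [exps_comp_perm, hes, List.countP_cons_of_pos (by simpa using hνM.le),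
      List.countP_cons_of_pos (by simp)] at hcnt
    cases es' with
    | nil => simp at hcnt
    | cons e₃ es'' =>
      have hs₃ : (e₃ :: es'').Pairwise (· ≤ ·) := (List.pairwise_cons.1 hs₂).2
      exact not_lt_triple_of_third_le₄₅ (head_le_of_countP_pos₄₅ hs₃ (by omega))
  · -- some weight exceeds `1/ν`: then the head of `exps γ` is `< ν`
    push Not at hle
    obtain ⟨x, hx⟩ := hle
    have hγx : γ x ≠ 0 := (lt_trans (inv_pos.2 hpq) hx).ne'
    have hlt : (γ x)⁻¹ < ν := inv_lt_of_inv_lt₀ hpq hx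
    have hmem' := inv_mem_exps_of_ne_zero₄₅ hγx
    obtain ⟨e, es, hes⟩ : ∃ e es, exps γ = e :: es := by
      cases hq : exps γ with
      | nil => rw [hq] at hmem'; simp at hmem'
      | cons e es => exact ⟨e, es, rfl⟩
    rw [hes] at hmem' hsorted ⊢
    have he : e < ν := (le_of_mem_of_pairwise₄₅ hsorted hmem').trans_lt hlt
    rw [ATW.TruncLex.cons_lt_cons]
    rintro (h1 | ⟨h2, -⟩)
    · exact lt_asymm he h1
    · exact he.ne' h2

end Generic

/-! ## §1 Exponent vectors on four variables `(x, y1, y2, y3) = (X 0, X 1, X 2, X 3)` -/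

section Fin4

/-- The exponent vector `(a₀, a₁, a₂, a₃)` of `x^{a₀} y1^{a₁} y2^{a₂} y3^{a₃}` (plumbing). [cite: CossartJannsenSaito2020, Def. 8.1 (p. 117) (exponents `(A, B)` of the monomials `u^A y^B`)] -/
def expFin4 (a₀ a₁ a₂ a₃ : ℕ) : Fin 4 →₀ ℕ :=
  Finsupp.single 0 a₀ + Finsupp.single 1 a₁ + Finsupp.single 2 a₂ + Finsupp.single 3 a₃

/-- (plumbing) [cite: CossartJannsenSaito2020, Def. 8.1 (p. 117) (exponents `(A, B)` of the monomials `u^A y^B`)] -/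
@[simp] theorem expFin4_apply_zero (a₀ a₁ a₂ a₃ : ℕ) : expFin4 a₀ a₁ a₂ a₃ 0 = a₀ := by simp [expFin4]

/-- (plumbing) [cite: CossartJannsenSaito2020, Def. 8.1 (p. 117) (exponents `(A, B)` of the monomials `u^A y^B`)] -/
@[simp] theorem expFin4_apply_one (a₀ a₁ a₂ a₃ : ℕ) : expFin4 a₀ a₁ a₂ a₃ 1 = a₁ := by simp [expFin4]

/-- (plumbing) [cite: CossartJannsenSaito2020, Def. 8.1 (p. 117) (exponents `(A, B)` of the monomials `u^A y^B`)] -/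
@[simp] theorem expFin4_apply_two (a₀ a₁ a₂ a₃ : ℕ) : expFin4 a₀ a₁ a₂ a₃ 2 = a₂ := by simp [expFin4]

/-- (plumbing) [cite: CossartJannsenSaito2020, Def. 8.1 (p. 117) (exponents `(A, B)` of the monomials `u^A y^B`)] -/
@[simp] theorem expFin4_apply_three (a₀ a₁ a₂ a₃ : ℕ) : expFin4 a₀ a₁ a₂ a₃ 3 = a₃ := by simp [expFin4]

/-- Two exponent vectors agree iff componentwise (plumbing). [cite: CossartJannsenSaito2020, Def. 8.1 (p. 117) (exponents `(A, B)` of the monomials `u^A y^B`)] -/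
theorem expFin4_eq_iff {a₀ a₁ a₂ a₃ b₀ b₁ b₂ b₃ : ℕ} :
    expFin4 a₀ a₁ a₂ a₃ = expFin4 b₀ b₁ b₂ b₃ ↔ a₀ = b₀ ∧ a₁ = b₁ ∧ a₂ = b₂ ∧ a₃ = b₃ := by
  constructor
  · intro h
    exact ⟨by simpa using DFunLike.congr_fun h 0, by simpa using DFunLike.congr_fun h 1,
      by simpa using DFunLike.congr_fun h 2, by simpa using DFunLike.congr_fun h 3⟩
  · rintro ⟨rfl, rfl, rfl, rfl⟩
    rfl

/-- `|(a₀, a₁, a₂, a₃)| = a₀ + a₁ + a₂ + a₃` (plumbing). [cite: CossartJannsenSaito2020, Def. 8.1 (p. 117) (exponents `(A, B)` of the monomials `u^A y^B`)] -/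
theorem degree_expFin4 (a₀ a₁ a₂ a₃ : ℕ) : (expFin4 a₀ a₁ a₂ a₃).degree = a₀ + a₁ + a₂ + a₃ := by
  simp [expFin4, Finsupp.degree_single]

/-- `deg_w (a₀, a₁, a₂, a₃) = Σ aᵢ wᵢ`. [cite: AbramovichTemkinWlodarczyk2024, Rem. 2.4.2 (p. 1568)] -/
theorem weight_expFin4 (w : Fin 4 → ℕ) (a₀ a₁ a₂ a₃ : ℕ) :
    Finsupp.weight w (expFin4 a₀ a₁ a₂ a₃) = a₀ * w 0 + a₁ * w 1 + a₂ * w 2 + a₃ * w 3 := by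
  simp [expFin4, Finsupp.weight_single]

/-- `|B|` for the block `y = (y1)`. [cite: CossartJannsenSaito2020, Def. 8.1 (p. 117)] -/
theorem blockDeg_one_expFin4 (a₀ a₁ a₂ a₃ : ℕ) :
    blockDeg ({1} : Finset (Fin 4)) (expFin4 a₀ a₁ a₂ a₃) = a₁ := by
  rw [blockDeg_singleton, expFin4_apply_one]

/-- `|A|` for the block `y = (y1)`, `u = (x, y2, y3)`. [cite: CossartJannsenSaito2020, Def. 8.1 (p. 117)] -/
theorem coDeg_one_expFin4 (a₀ a₁ a₂ a₃ : ℕ) :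
    coDeg ({1} : Finset (Fin 4)) (expFin4 a₀ a₁ a₂ a₃) = a₀ + a₂ + a₃ := by
  rw [coDeg_singleton, degree_expFin4, expFin4_apply_one]
  omega

variable (k) in
/-- `x^{a₀} y1^{a₁} y2^{a₂} y3^{a₃}` as a `monomial` (plumbing). [cite: CossartJannsenSaito2020, Def. 8.1 (p. 117) (exponents `(A, B)` of the monomials `u^A y^B`)] -/
theorem monomial_expFin4 (a₀ a₁ a₂ a₃ : ℕ) :
    (monomial (expFin4 a₀ a₁ a₂ a₃) 1 : MvPolynomial (Fin 4) k) = X 0 ^ a₀ * X 1 ^ a₁ * X 2 ^ a₂ * X 3 ^ a₃ := by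
  simp only [X_pow_eq_monomial, monomial_mul, mul_one, expFin4]

end Fin4

/-! ## §2 The family `F = x^q + h_{p,a,m}`, `h = y3^{q/p} + Φ`, `Φ = ℓ^{p^{a−1}} + y2^n ℓ^{p^{a−2}}`,
`ℓ = y1^p − y2^{mp} y3` — parametrised by `a = b + 2 ≥ 2` and `q = p^{c+1}` -/

section BentFamily

/-- `n = (mp+1)·p^{a−2}·(p−1)` (`a = b + 2`). (cell notation, engine-1 gen 28) [cite: AbramovichTemkinWlodarczyk2024, Thm. 5.3.1 (2) (p. 1578)] -/
def bentN (p b m : ℕ) : ℕ := (m * p + 1) * p ^ b * (p - 1)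

/-- `D = (mp+1)·p^{a−1}` (`a = b + 2`): the repeated entry of the invariant `(p^a, D, D)`; `δ = D/p^a = (mp+1)/p`.
(cell notation) [cite: AbramovichTemkinWlodarczyk2024, Thm. 5.3.1 (2) (p. 1578)] -/
def bentD (p b m : ℕ) : ℕ := (m * p + 1) * p ^ (b + 1)

variable (k) in
/-- The `δ`-face polynomial `Φ_{p,a,m} = y1^{p^a} − y2^{m p^a} y3^{p^{a−1}} + y1^{p^{a−1}} y2^n − y2^{n + m p^{a−1}} y3^{p^{a−2}}`
(`= ℓ^{p^{a−1}} + y2^n ℓ^{p^{a−2}}` in characteristic `p`, `bentFace_eq_factored`). (cell's family, engine-1 gen 28;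
derived here) [cite: CossartJannsenSaito2020, Def. 8.2 (4) (p. 118) (in_δ)] -/
def bentFace (p b m : ℕ) : MvPolynomial (Fin 4) k :=
  X 1 ^ p ^ (b + 2) - X 2 ^ (m * p ^ (b + 2)) * X 3 ^ p ^ (b + 1)
    + X 1 ^ p ^ (b + 1) * X 2 ^ bentN p b m - X 2 ^ (bentN p b m + m * p ^ (b + 1)) * X 3 ^ p ^ b

variable (k) in
/-- `h_{p,a,m} = y3^{q/p} + Φ_{p,a,m}` (`q/p = p^c`). (cell's family, engine-1 gen 28) [cite: Hauser2010, §C (p. 9) (the residual polynomial `h` of `x^p + h`)] -/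
def bentH (p b m c : ℕ) : MvPolynomial (Fin 4) k := X 3 ^ p ^ c + bentFace k p b m

variable (k) in
/-- `F_{p,a,m,q} = x^q + h_{p,a,m}`, `q = p^{c+1}`: a purely inseparable point `x^q + h(y)`. (cell's family,
engine-1 gen 28) [cite: Hauser2010, §C (p. 9) (purely inseparable equations `x^p + h` and the failure of maximal
contact)] -/
def bentF (p b m c : ℕ) : MvPolynomial (Fin 4) k := X 0 ^ p ^ (c + 1) + bentH k p b m c

variable (k) in
/-- **The bent coordinate change** `Ψ`: FIRST `y3 ↦ y3 + x^p`, THEN `y1 ↦ y1 + x·y2^m` (`x, y2` fixed) — the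
`𝔾_a`-action `σ_x` fixing `ℓ = y1^p − y2^{mp} y3` up to `p`-th powers. (cell's centre `Z_B`, engine-1 gen 28)
[cite: CossartJannsenSaito2020, Def. 8.2 / Thm. 8.16 (p. 121) (coordinate changes `y ↦ y + q(u)`)] -/
def bentShear (p m : ℕ) : MvPolynomial (Fin 4) k ≃ₐ[k] MvPolynomial (Fin 4) k :=
  (addPolyShear 3 (X 0 ^ p)).trans (addPolyShear 1 (X 0 * X 2 ^ m))

/-- **The bent cocharacter** `γ = (0; p^{−a}, 1/D, 1/D)` on `(x; y1, y2, y3)`: `x` is a free slot.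
[cite: AbramovichTemkinWlodarczyk2024, §5.1 and Thm. 5.3.1 (2) (p. 1578)] -/
def bentWeights (p b m : ℕ) : Fin 4 → ℚ := umbrellaWeights 1 2 3 (p ^ (b + 2)) (bentD p b m - 1)

/-- Integer weights `w = (0; mp+1, p, p)` with `w = p·D·γ`. [cite: AbramovichTemkinWlodarczyk2024, Rem. 2.4.2 (p. 1568)] -/
def bentW (p m : ℕ) : Fin 4 → ℕ := fun i => if i = 0 then 0 else if i = 1 then m * p + 1 else p

variable {p b m c : ℕ}

/-! ### §2.1 Exponent arithmetic -/

/-- `D = m p^{a} + p^{a−1}` (plumbing). [folklore] -/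
private theorem bentD_eq₄₅ (p b m : ℕ) : bentD p b m = m * p ^ (b + 2) + p ^ (b + 1) := by
  unfold bentD; ring

/-- `n + m p^{a−1} + p^{a−2} = D` (plumbing). [folklore] -/
private theorem bentN_add₄₅ (hp : 1 ≤ p) (b m : ℕ) : bentN p b m + m * p ^ (b + 1) + p ^ b = bentD p b m := by
  obtain ⟨r, rfl⟩ : ∃ r, p = r + 1 := ⟨p - 1, by omega⟩
  unfold bentN bentD
  rw [Nat.add_sub_cancel]
  ring

/-- `p^{a−1}(mp+1) + p·n = p·D` (plumbing). [folklore] -/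
private theorem bentN_weight₄₅ (hp : 1 ≤ p) (b m : ℕ) :
    p ^ (b + 1) * (m * p + 1) + bentN p b m * p = p * bentD p b m := by
  obtain ⟨r, rfl⟩ : ∃ r, p = r + 1 := ⟨p - 1, by omega⟩
  unfold bentN bentD
  rw [Nat.add_sub_cancel]
  ring

/-- `p·D = (mp+1)·p^a` (plumbing). [folklore] -/
private theorem p_mul_bentD₄₅ (p b m : ℕ) : p * bentD p b m = (m * p + 1) * p ^ (b + 2) := by
  unfold bentD; ring

/-- `p^a < D` when `m ≥ 1` (plumbing). [folklore] -/
private theorem nu_lt_bentD₄₅ (hp : 1 ≤ p) (hm : 1 ≤ m) (b : ℕ) : p ^ (b + 2) < bentD p b m := by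
  unfold bentD
  rw [pow_succ p (b + 1), mul_comm]
  exact Nat.mul_lt_mul_of_pos_right (by nlinarith) (by positivity)

/-- `p^a < p^{a−1} + n` when `p ≥ 2`, `m ≥ 1` (plumbing). [folklore] -/
private theorem nu_lt_bentD5₄₅ (hp : 2 ≤ p) (hm : 1 ≤ m) (b : ℕ) : p ^ (b + 2) < p ^ (b + 1) + bentN p b m := by
  obtain ⟨s, rfl⟩ : ∃ s, p = s + 2 := ⟨p - 2, by omega⟩
  unfold bentN
  rw [show s + 2 - 1 = s + 1 by omega]
  have h1 : (s + 3) * (s + 2) ^ b * (s + 1) ≤ (m * (s + 2) + 1) * (s + 2) ^ b * (s + 1) :=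
    Nat.mul_le_mul_right _ (Nat.mul_le_mul_right _ (by nlinarith))
  have h2 : (s + 2) ^ (b + 2) < (s + 2) ^ (b + 1) + (s + 3) * (s + 2) ^ b * (s + 1) := by
    have : (s + 2) ^ (b + 1) + (s + 3) * (s + 2) ^ b * (s + 1) = (s + 2) ^ (b + 2) + (s + 2) ^ b * (s + 1) := by
      ring
    rw [this]
    have : 0 < (s + 2) ^ b * (s + 1) := by positivity
    omega
  omega

/-- `D < q/p` from `q > p^a (mp+1)` (plumbing). [folklore] -/
private theorem bentD_lt_of_hq₄₅ (hq : (m * p + 1) * p ^ (b + 2) < p ^ (c + 1)) : bentD p b m < p ^ c := by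
  rw [← p_mul_bentD₄₅, pow_succ'] at hq
  exact Nat.lt_of_mul_lt_mul_left hq

/-- `δ = D/p^a = (mp+1)/p` is not an integer when `p ≥ 2` (plumbing). [folklore] -/
private theorem natCast_ne_bentDelta₄₅ (hp : 2 ≤ p) (b m q : ℕ) :
    (q : ℚ) ≠ ((bentD p b m : ℕ) : ℚ) / ((p ^ (b + 2) : ℕ) : ℚ) := by
  intro h
  have hν : ((p ^ (b + 2) : ℕ) : ℚ) ≠ 0 := by positivity
  rw [eq_div_iff hν] at h
  have h' : q * p * p ^ (b + 1) = (m * p + 1) * p ^ (b + 1) := by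
    have h'' : q * p ^ (b + 2) = bentD p b m := by exact_mod_cast h
    rw [show q * p * p ^ (b + 1) = q * p ^ (b + 2) by ring, h'', bentD]
  have h2 : q * p = m * p + 1 := Nat.eq_of_mul_eq_mul_right (by positivity) h'
  have h3 : p ∣ 1 := (Nat.dvd_add_right (dvd_mul_left p m)).1 (h2 ▸ dvd_mul_left p q)
  have := Nat.le_of_dvd one_pos h3
  omega

/-- `n·p^a = D·(p^a − p^{a−1})`: the monomial `y1^{p^{a−1}} y2^n` lies ON the `δ`-face (plumbing). [folklore] -/
private theorem bentN_face₄₅ (p b m : ℕ) :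
    ((bentN p b m : ℕ) : ℚ) * ((p ^ (b + 2) : ℕ) : ℚ) =
      ((bentD p b m : ℕ) : ℚ) * (((p ^ (b + 2) - p ^ (b + 1) : ℕ) : ℕ) : ℚ) := by
  have hsub : p ^ (b + 2) - p ^ (b + 1) = p ^ (b + 1) * (p - 1) := by
    rw [Nat.mul_sub_one, ← pow_succ]
  rw [hsub]
  unfold bentN bentD
  push_cast
  ring

/-! ### §2.2 The five monomials of `h` -/

/-- `h` as a signed sum of five monomials. (derived here) [cite: CossartJannsenSaito2020, Def. 8.2 (p. 118)] -/
theorem bentH_eq_monomial (p b m c : ℕ) : bentH k p b m c =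
    monomial (expFin4 0 0 0 (p ^ c)) 1 + (monomial (expFin4 0 (p ^ (b + 2)) 0 0) 1
      - monomial (expFin4 0 0 (m * p ^ (b + 2)) (p ^ (b + 1))) 1
      + monomial (expFin4 0 (p ^ (b + 1)) (bentN p b m) 0) 1
      - monomial (expFin4 0 0 (bentN p b m + m * p ^ (b + 1)) (p ^ b)) 1) := by
  simp only [bentH, bentFace, monomial_expFin4, pow_zero, one_mul, mul_one]

/-- **Coefficients of `h`.** (derived here) [cite: CossartJannsenSaito2020, Def. 8.2 (p. 118)] -/
theorem coeff_bentH (p b m c : ℕ) (d : Fin 4 →₀ ℕ) : coeff d (bentH k p b m c) =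
    (if expFin4 0 0 0 (p ^ c) = d then 1 else 0) + ((if expFin4 0 (p ^ (b + 2)) 0 0 = d then 1 else 0)
      - (if expFin4 0 0 (m * p ^ (b + 2)) (p ^ (b + 1)) = d then 1 else 0)
      + (if expFin4 0 (p ^ (b + 1)) (bentN p b m) 0 = d then 1 else 0)
      - (if expFin4 0 0 (bentN p b m + m * p ^ (b + 1)) (p ^ b) = d then 1 else 0)) := by
  rw [bentH_eq_monomial]
  simp only [coeff_add, coeff_sub, coeff_monomial]

/-- **The support of `h`** is contained in its five exponent vectors. (derived here)
[cite: CossartJannsenSaito2020, Def. 8.2 (p. 118)] -/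
theorem support_bentH_subset (p b m c : ℕ) : (bentH k p b m c).support ⊆
    {expFin4 0 0 0 (p ^ c), expFin4 0 (p ^ (b + 2)) 0 0, expFin4 0 0 (m * p ^ (b + 2)) (p ^ (b + 1)),
      expFin4 0 (p ^ (b + 1)) (bentN p b m) 0, expFin4 0 0 (bentN p b m + m * p ^ (b + 1)) (p ^ b)} := by
  intro d hd
  simp only [Finset.mem_insert, Finset.mem_singleton]
  by_contra h
  simp only [not_or] at h
  obtain ⟨h0, h1, h2, h3, h4⟩ := h
  rw [mem_support_iff, coeff_bentH, if_neg (Ne.symm h0), if_neg (Ne.symm h1), if_neg (Ne.symm h2),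
    if_neg (Ne.symm h3), if_neg (Ne.symm h4)] at hd
  simp at hd

/-- The coefficient of `y1^{p^a}` in `h` is `1` (plumbing). [folklore] -/
private theorem coeff_e1_bentH₄₅ (hp : 2 ≤ p) (c : ℕ) :
    coeff (expFin4 0 (p ^ (b + 2)) 0 0) (bentH k p b m c) = 1 := by
  have hν : p ^ (b + 2) ≠ 0 := by positivity
  have hν' : p ^ (b + 2) ≠ p ^ (b + 1) := (Nat.pow_lt_pow_right (by omega) (by omega)).ne'
  rw [coeff_bentH, if_neg, if_pos rfl, if_neg, if_neg, if_neg]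
  · simp
  all_goals rw [expFin4_eq_iff]; omega

/-- The coefficient of `y2^{m p^a} y3^{p^{a−1}}` in `h` is `−1` (plumbing). [folklore] -/
private theorem coeff_e2_bentH₄₅ (hp : 2 ≤ p) (hq : (m * p + 1) * p ^ (b + 2) < p ^ (c + 1)) :
    coeff (expFin4 0 0 (m * p ^ (b + 2)) (p ^ (b + 1))) (bentH k p b m c) = -1 := by
  have hν : p ^ (b + 2) ≠ 0 := by positivity
  have h1 : p ^ (b + 1) ≠ 0 := by positivity
  have h2 : p ^ (b + 1) ≠ p ^ b := (Nat.pow_lt_pow_right (by omega) (by omega)).ne'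
  have h3 : p ^ c ≠ p ^ (b + 1) := by
    have := bentD_lt_of_hq₄₅ hq
    rw [bentD_eq₄₅] at this
    omega
  rw [coeff_bentH, if_neg, if_neg, if_pos rfl, if_neg, if_neg]
  · simp
  all_goals rw [expFin4_eq_iff]; omega

/-- `(X1^p − X2^{mp} X3)`-factored form of `Φ` in characteristic `p`: `Φ = ℓ^{p^{a−1}} + y2^n·ℓ^{p^{a−2}}`.
(derived here) [cite: CossartJannsenSaito2020, Def. 8.2 (4) (p. 118)] -/
theorem bentFace_eq_factored [hp : Fact p.Prime] [CharP k p] (b m : ℕ) :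
    bentFace k p b m = (X 1 ^ p - X 2 ^ (m * p) * X 3) ^ p ^ (b + 1)
      + X 2 ^ bentN p b m * (X 1 ^ p - X 2 ^ (m * p) * X 3) ^ p ^ b := by
  rw [sub_pow_char_pow (p := p), sub_pow_char_pow (p := p), mul_pow, mul_pow, ← pow_mul, ← pow_mul, ← pow_mul,
    ← pow_mul, bentFace]
  ring

/-! ### §2.3 The bent coordinate change carries `F` to `h` -/

/-- The inverse shear on the sheared variable (plumbing). [folklore] -/
private theorem addPolyShear_symm_X_self₄₅ {σ : Type*} [DecidableEq σ] (a : σ) (q : MvPolynomial σ k) :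
    (addPolyShear a q).symm (X a) = X a - killVar a q := by
  simp [addPolyShear, sub_eq_add_neg]

/-- The inverse shear fixes the other variables (plumbing). [folklore] -/
private theorem addPolyShear_symm_X_of_ne₄₅ {σ : Type*} [DecidableEq σ] (a : σ) (q : MvPolynomial σ k) {x : σ}
    (hx : x ≠ a) : (addPolyShear a q).symm (X x) = X x := by
  simp [addPolyShear, hx]

/-- `y3 ∉ vars (x^p)` (plumbing). [folklore] -/
private theorem three_notMem_vars₄₅ (p : ℕ) : (3 : Fin 4) ∉ (X 0 ^ p : MvPolynomial (Fin 4) k).vars := by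
  intro h
  have := vars_pow _ _ h
  rw [vars_X] at this
  exact absurd (Finset.mem_singleton.1 this) (by decide)

/-- `y1 ∉ vars (x y2^m)` (plumbing). [folklore] -/
private theorem one_notMem_vars₄₅ (m : ℕ) : (1 : Fin 4) ∉ (X 0 * X 2 ^ m : MvPolynomial (Fin 4) k).vars := by
  intro h
  rcases Finset.mem_union.1 (vars_mul _ _ h) with h0 | h2
  · rw [vars_X] at h0
    exact absurd (Finset.mem_singleton.1 h0) (by decide)
  · have := vars_pow _ _ h2
    rw [vars_X] at this
    exact absurd (Finset.mem_singleton.1 this) (by decide)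

/-- `Ψ⁻¹(x) = x`. (derived here) [cite: CossartJannsenSaito2020, Def. 8.2 (p. 118)] -/
theorem bentShear_symm_X_zero (p m : ℕ) : (bentShear k p m).symm (X 0) = X 0 := by
  rw [bentShear, AlgEquiv.symm_trans_apply, addPolyShear_symm_X_of_ne₄₅ 1 _ (by decide),
    addPolyShear_symm_X_of_ne₄₅ 3 _ (by decide)]

/-- `Ψ⁻¹(y1) = y1 − x·y2^m`. (derived here) [cite: CossartJannsenSaito2020, Def. 8.2 (p. 118)] -/
theorem bentShear_symm_X_one (p m : ℕ) : (bentShear k p m).symm (X 1) = X 1 - X 0 * X 2 ^ m := by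
  rw [bentShear, AlgEquiv.symm_trans_apply, addPolyShear_symm_X_self₄₅,
    killVar_eq_self_of_notMem (one_notMem_vars₄₅ (k := k) m), map_sub, map_mul, map_pow,
    addPolyShear_symm_X_of_ne₄₅ 3 _ (by decide), addPolyShear_symm_X_of_ne₄₅ 3 _ (by decide),
    addPolyShear_symm_X_of_ne₄₅ 3 _ (by decide)]

/-- `Ψ⁻¹(y2) = y2`. (derived here) [cite: CossartJannsenSaito2020, Def. 8.2 (p. 118)] -/
theorem bentShear_symm_X_two (p m : ℕ) : (bentShear k p m).symm (X 2) = X 2 := by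
  rw [bentShear, AlgEquiv.symm_trans_apply, addPolyShear_symm_X_of_ne₄₅ 1 _ (by decide),
    addPolyShear_symm_X_of_ne₄₅ 3 _ (by decide)]

/-- `Ψ⁻¹(y3) = y3 − x^p`. (derived here) [cite: CossartJannsenSaito2020, Def. 8.2 (p. 118)] -/
theorem bentShear_symm_X_three (p m : ℕ) : (bentShear k p m).symm (X 3) = X 3 - X 0 ^ p := by
  rw [bentShear, AlgEquiv.symm_trans_apply, addPolyShear_symm_X_of_ne₄₅ 1 _ (by decide),
    addPolyShear_symm_X_self₄₅, killVar_eq_self_of_notMem (three_notMem_vars₄₅ (k := k) p)]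

/-- `Ψ` fixes the origin. (derived here) [cite: AbramovichTemkinWlodarczyk2024, Lemma 5.2.10 (p. 1577)] -/
theorem constantCoeff_bentShear_X (hp : 1 ≤ p) (m : ℕ) (i : Fin 4) :
    constantCoeff (bentShear k p m (X i)) = 0 := by
  refine forall_constantCoeff_trans_X (constantCoeff_addPolyShear_X 3 ?_) (constantCoeff_addPolyShear_X 1 ?_) i
  · rw [map_pow, constantCoeff_X, zero_pow (by omega)]
  · rw [map_mul, constantCoeff_X, zero_mul]

/-- **`F` in the bent coordinates is `h`**: `Ψ⁻¹(x^q + h) = h`, i.e. `F(x, y1 − x y2^m, y2, y3 − x^p) = h(y1, y2, y3)`: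
`(y3 − x^p)^{q/p} = y3^{q/p} − x^q` cancels `x^q`, and `ℓ(y1 − x y2^m, y2, y3 − x^p) = ℓ(y1, y2, y3)` by Frobenius.
(derived here; the cell's Theorem 1(a) identity `F∘Z_B⁻¹ = h`) [cite: CossartJannsenSaito2020, Thm. 8.16 (p. 121)]
[cite: Hauser2010, §D (p. 12) (kangaroo phenomenon: coordinate changes mixing `x` into `y`)] -/
theorem bentShear_symm_bentF [hp : Fact p.Prime] [CharP k p] (b m c : ℕ) :
    (bentShear k p m).symm (bentF k p b m c) = bentH k p b m c := by
  simp only [bentF, bentH, bentFace, map_add, map_sub, map_mul, map_pow, bentShear_symm_X_zero,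
    bentShear_symm_X_one, bentShear_symm_X_two, bentShear_symm_X_three]
  rw [sub_pow_char_pow (p := p), sub_pow_char_pow (p := p), sub_pow_char_pow (p := p),
    sub_pow_char_pow (p := p), sub_pow_char_pow (p := p)]
  simp only [mul_pow, ← pow_mul]
  ring

/-- Hence `F = Ψ(h)` and **`W(F) = W(h)`**. (derived here)
[cite: AbramovichTemkinWlodarczyk2024, Thm. 5.3.1 (3) (p. 1578) (independence of coordinates)] -/
theorem admissibleInvariants_bentF [hp : Fact p.Prime] [CharP k p] (b m c : ℕ) :
    admissibleInvariants (bentF k p b m c) = admissibleInvariants (bentH k p b m c) := by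
  have h : bentF k p b m c = bentShear k p m (bentH k p b m c) := by
    rw [← bentShear_symm_bentF, AlgEquiv.apply_symm_apply]
  rw [h, admissibleInvariants_map_eq _ (constantCoeff_bentShear_X hp.out.one_lt.le m)]

/-! ### §2.4 The bent centre is admissible, with invariant `(p^a, D, D)` -/

/-- `D ≥ 1` (plumbing). [folklore] -/
private theorem bentD_pos₄₅ (hp : 1 ≤ p) (b m : ℕ) : 0 < bentD p b m := by
  unfold bentD; positivity

/-- `D − 1 + 1 = D` (plumbing). [folklore] -/
private theorem bentD_sub_add₄₅ (hp : 1 ≤ p) (b m : ℕ) : bentD p b m - 1 + 1 = bentD p b m :=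
  Nat.sub_add_cancel (bentD_pos₄₅ hp b m)

/-- `γ(x) = 0`: `x` is a free slot. [cite: AbramovichTemkinWlodarczyk2024, §5.1] -/
theorem bentWeights_zero (p b m : ℕ) : bentWeights p b m 0 = 0 := by
  simp [bentWeights, umbrellaWeights]

/-- `γ(y1) = p^{−a}`. [cite: AbramovichTemkinWlodarczyk2024, §5.1] -/
theorem bentWeights_one (p b m : ℕ) : bentWeights p b m 1 = (((p ^ (b + 2) : ℕ) : ℚ))⁻¹ := by
  simp [bentWeights, umbrellaWeights]

/-- `γ(y2) = 1/D`. [cite: AbramovichTemkinWlodarczyk2024, §5.1] -/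
theorem bentWeights_two (hp : 1 ≤ p) (b m : ℕ) : bentWeights p b m 2 = (((bentD p b m : ℕ) : ℚ))⁻¹ := by
  simp [bentWeights, umbrellaWeights, bentD_sub_add₄₅ hp]

/-- `γ(y3) = 1/D`. [cite: AbramovichTemkinWlodarczyk2024, §5.1] -/
theorem bentWeights_three (hp : 1 ≤ p) (b m : ℕ) : bentWeights p b m 3 = (((bentD p b m : ℕ) : ℚ))⁻¹ := by
  simp [bentWeights, umbrellaWeights, bentD_sub_add₄₅ hp]

/-- **`exps γ = (p^a, D, D)`.** (derived here) [cite: AbramovichTemkinWlodarczyk2024, Thm. 5.3.1 (2) (p. 1578)] -/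
theorem exps_bentWeights (hp : 1 ≤ p) (hm : 1 ≤ m) (b : ℕ) :
    exps (bentWeights p b m) = [((p ^ (b + 2) : ℕ) : ℚ), ((bentD p b m : ℕ) : ℚ), ((bentD p b m : ℕ) : ℚ)] := by
  rw [bentWeights, exps_umbrellaWeights (by decide) (by decide) (by decide) (by positivity)
    (by rw [bentD_sub_add₄₅ hp]; exact (nu_lt_bentD₄₅ hp hm b).le), bentD_sub_add₄₅ hp]

/-- Values of the integer weights (plumbing). [folklore] -/
private theorem bentW_apply₄₅ (p m : ℕ) :
    bentW p m 0 = 0 ∧ bentW p m 1 = m * p + 1 ∧ bentW p m 2 = p ∧ bentW p m 3 = p := by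
  simp [bentW]

/-- `w = p·D·γ` (plumbing). [cite: AbramovichTemkinWlodarczyk2024, Rem. 2.4.2 (p. 1568)] -/
private theorem bentW_eq_mul_bentWeights₄₅ (hp : 1 ≤ p) (b m : ℕ) (i : Fin 4) :
    ((bentW p m i : ℕ) : ℚ) = ((p * bentD p b m : ℕ) : ℚ) * bentWeights p b m i := by
  obtain ⟨h0, h1, h2, h3⟩ := bentW_apply₄₅ p m
  have hpq : (p : ℚ) ≠ 0 := by positivity
  have hDq : ((bentD p b m : ℕ) : ℚ) ≠ 0 := by
    have := bentD_pos₄₅ hp b m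
    positivity
  have hνq : ((p ^ (b + 2) : ℕ) : ℚ) ≠ 0 := by positivity
  fin_cases i
  · simp [h0, bentWeights_zero]
  · simp only [Fin.mk_one, Fin.isValue, h1, bentWeights_one, p_mul_bentD₄₅, Nat.cast_mul,
      mul_inv_cancel_right₀ hνq]
  · simp only [Fin.reduceFinMk, h2, bentWeights_two hp, Nat.cast_mul, mul_inv_cancel_right₀ hDq]
  · simp only [Fin.reduceFinMk, h3, bentWeights_three hp, Nat.cast_mul, mul_inv_cancel_right₀ hDq]

/-- **`γ` is admissible for `h`**: the five monomials have `w`-weight `q, pD, pD, pD, pD ≥ pD` for `w = (0; mp+1, p, p)`.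
(derived here) [cite: AbramovichTemkinWlodarczyk2024, Thm. 5.3.1 (2) (p. 1578), Lemma 5.2.6 (p. 1577)] -/
theorem isAdmissibleFor_bentH (hp : 2 ≤ p) (hq : (m * p + 1) * p ^ (b + 2) < p ^ (c + 1)) :
    IsAdmissibleFor (bentWeights p b m) (bentH k p b m c) := by
  classical
  have hp1 : 1 ≤ p := by omega
  have hD := bentD_pos₄₅ hp1 b m
  obtain ⟨h0, h1, h2, h3⟩ := bentW_apply₄₅ p m
  rw [isAdmissibleFor_iff_le_monomialOrd _ (bentW p m) (N := p * bentD p b m) (by positivity)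
    (bentW_eq_mul_bentWeights₄₅ hp1 b m), le_monomialOrd_iff]
  intro d hd
  have hc := bentD_lt_of_hq₄₅ hq
  have e1 := bentD_eq₄₅ p b m
  have e2 := bentN_add₄₅ hp1 b m
  have e3 := bentN_weight₄₅ hp1 b m
  have e4 := p_mul_bentD₄₅ p b m
  rcases (by simpa only [Finset.mem_insert, Finset.mem_singleton] using support_bentH_subset p b m c hd :
      d = _ ∨ d = _ ∨ d = _ ∨ d = _ ∨ d = _) with rfl | rfl | rfl | rfl | rfl <;>
    rw [weight_expFin4, h0, h1, h2, h3]
  · simp only [zero_mul, zero_add]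
    rw [mul_comm (p ^ c) p]
    exact Nat.mul_le_mul_left p hc.le
  · rw [e4]; ring_nf; exact le_rfl
  · have : m * p ^ (b + 2) * p + p ^ (b + 1) * p = p * bentD p b m := by rw [bentD]; ring
    omega
  · omega
  · have : (bentN p b m + m * p ^ (b + 1)) * p + p ^ b * p = p * bentD p b m := by rw [← e2]; ring
    omega

variable (k) in
/-- **The bent centre `Z_B = (Ψ, γ)` is a centre for `F`** (the cell's Theorem 1(a), typed): origin fixed, `γ ≥ 0`,
and `Ψ⁻¹ F = h` has `v_γ ≥ 1`. It is non-split: `x` is mixed into `y1, y3`. (derived here)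
[cite: AbramovichTemkinWlodarczyk2024, Thm. 5.3.1 (2) (p. 1578)] [cite: Hauser2010, §C (p. 9), §D (p. 12)] -/
theorem isCentreFor_bent [hp : Fact p.Prime] [CharP k p] (hq : (m * p + 1) * p ^ (b + 2) < p ^ (c + 1)) :
    IsCentreFor (bentF k p b m c) (bentShear k p m) (bentWeights p b m) := by
  refine ⟨constantCoeff_bentShear_X hp.out.one_lt.le m, fun i => ?_, ?_⟩
  · unfold bentWeights umbrellaWeights
    split_ifs <;> positivity
  · rw [bentShear_symm_bentF]
    exact isAdmissibleFor_bentH hp.out.two_le hq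

/-- **The identity centre `(id, γ)` is a centre for `h`** — in every characteristic, `p ≥ 2` any integer.
(derived here) [cite: AbramovichTemkinWlodarczyk2024, Thm. 5.3.1 (2) (p. 1578)] -/
theorem isCentreFor_bentH_refl (hp : 2 ≤ p) (hq : (m * p + 1) * p ^ (b + 2) < p ^ (c + 1)) :
    IsCentreFor (bentH k p b m c) AlgEquiv.refl (bentWeights p b m) := by
  refine ⟨fun i => by simp, fun i => ?_, ?_⟩
  · unfold bentWeights umbrellaWeights
    split_ifs <;> positivity
  · rw [AlgEquiv.refl_symm, AlgEquiv.coe_refl, id]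
    exact isAdmissibleFor_bentH hp hq

/-- **`(p^a, D, D) ∈ W(h)`** over every field. (derived here) [cite: AbramovichTemkinWlodarczyk2024, Thm. 5.3.1 (2)] -/
theorem bentH_mem_admissibleInvariants (hp : 2 ≤ p) (hm : 1 ≤ m)
    (hq : (m * p + 1) * p ^ (b + 2) < p ^ (c + 1)) :
    [((p ^ (b + 2) : ℕ) : ℚ), ((bentD p b m : ℕ) : ℚ), ((bentD p b m : ℕ) : ℚ)] ∈
      admissibleInvariants (bentH k p b m c) := by
  rw [← exps_bentWeights (by omega) hm]
  exact exps_mem_admissibleInvariants (isCentreFor_bentH_refl hp hq)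

/-- **`(p^a, D, D) ∈ W(F)`** in characteristic `p`, via the bent centre. (derived here; the cell's Theorem 1(a))
[cite: AbramovichTemkinWlodarczyk2024, Thm. 5.3.1 (2) (p. 1578)] [cite: Hauser2010, §C (p. 9)] -/
theorem bent_mem_admissibleInvariants [hp : Fact p.Prime] [CharP k p] (hm : 1 ≤ m)
    (hq : (m * p + 1) * p ^ (b + 2) < p ^ (c + 1)) :
    [((p ^ (b + 2) : ℕ) : ℚ), ((bentD p b m : ℕ) : ℚ), ((bentD p b m : ℕ) : ℚ)] ∈
      admissibleInvariants (bentF k p b m c) := by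
  rw [← exps_bentWeights hp.out.one_lt.le hm]
  exact exps_mem_admissibleInvariants (isCentreFor_bent k hq)

/-! ### §2.5 The bent centre is not `T`-tight -/

/-- **`T`-tightness** of a centre `(Ψ, γ)` of `x^q + h` relative to the purely inseparable variable `x`
(the CELL's engine-side test, engine-1 gens 25–28 — NOT a notion from the literature): every term
`c·x^s·y^μ` (`s ≥ 1`) of every old parameter `yᵢ = Ψ⁻¹(Xᵢ)` written in the new ones has SPLIT VALUE
`s/q + ⟨μ, γ⟩ ≥ γᵢ`.  (A centre obtained by first splitting off `x` with weight `1/q` is `T`-tight.)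
[cite: CossartJannsenSaito2020, Def. 8.2 / Thm. 8.16 (p. 121) (the terms of a preparation `y ↦ y + q(u)`)] -/
def IsTTight (q : ℕ) (x : Fin N) (Ψ : MvPolynomial (Fin N) k ≃ₐ[k] MvPolynomial (Fin N) k) (γ : Fin N → ℚ) :
    Prop :=
  ∀ i, ∀ d ∈ (Ψ.symm (X i)).support, 0 < d x → γ i ≤ monomialValuation (Function.update γ x (1 / (q : ℚ))) d

/-- `v_γ(x^{a₀} y1^{a₁} y2^{a₂} y3^{a₃}) = Σ aᵢ γᵢ`. [cite: AbramovichTemkinWlodarczyk2024, §2.4 (monomial valuation of a center)] -/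
theorem monomialValuation_expFin4 (γ : Fin 4 → ℚ) (a₀ a₁ a₂ a₃ : ℕ) :
    monomialValuation γ (expFin4 a₀ a₁ a₂ a₃) = a₀ * γ 0 + a₁ * γ 1 + a₂ * γ 2 + a₃ * γ 3 := by
  rw [monomialValuation, Finsupp.sum_fintype _ _ (fun _ => by simp)]
  simp [Fin.sum_univ_four]

/-- **The bent centre is not `T`-tight**: the term `x·y2^m` of `Ψ⁻¹(y1) = y1 − x y2^m` has split value
`1/q + m/D < p^{−a} = γ(y1)` — equivalently `q > p^a (mp+1)`. (derived here; the cell's Theorem 1(a), `θ(Z_B) > 1/q`)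
[cite: Hauser2010, §D (p. 12)] [cite: CossartJannsenSaito2020, Thm. 8.16 (p. 121)] -/
theorem not_isTTight_bent (hp : 2 ≤ p) (hm : 1 ≤ m) (hq : (m * p + 1) * p ^ (b + 2) < p ^ (c + 1)) :
    ¬ IsTTight (p ^ (c + 1)) 0 (bentShear k p m) (bentWeights p b m) := by
  classical
  have hp1 : 1 ≤ p := by omega
  intro h
  have hmon : (X 0 * X 2 ^ m : MvPolynomial (Fin 4) k) = monomial (expFin4 1 0 m 0) 1 := by
    rw [monomial_expFin4]; simp
  have hX1 : (X 1 : MvPolynomial (Fin 4) k) = monomial (expFin4 0 1 0 0) 1 := by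
    rw [monomial_expFin4]; simp
  have hmem : expFin4 1 0 m 0 ∈ ((bentShear k p m).symm (X 1)).support := by
    rw [bentShear_symm_X_one, hmon, hX1, mem_support_iff, coeff_sub, coeff_monomial, coeff_monomial, if_neg,
      if_pos rfl]
    · norm_num
    · rw [expFin4_eq_iff]; omega
  have hle := h 1 _ hmem (by simp)
  rw [monomialValuation_expFin4] at hle
  simp only [Function.update_self, Function.update_of_ne (show (1 : Fin 4) ≠ 0 by decide),
    Function.update_of_ne (show (2 : Fin 4) ≠ 0 by decide), Function.update_of_ne (show (3 : Fin 4) ≠ 0 by decide),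
    bentWeights_one, bentWeights_two hp1, Nat.cast_zero, Nat.cast_one, zero_mul, add_zero, one_mul] at hle
  -- `hle : (p^a)⁻¹ ≤ 1/q + m/D`; but `q > p^a (mp+1)` says the opposite
  have hD : (0 : ℚ) < ((bentD p b m : ℕ) : ℚ) := by exact_mod_cast bentD_pos₄₅ hp1 b m
  have hν : (0 : ℚ) < ((p ^ (b + 2) : ℕ) : ℚ) := by positivity
  have hq' : (0 : ℚ) < ((p ^ (c + 1) : ℕ) : ℚ) := by positivity
  have key : ((bentD p b m : ℕ) : ℚ) * ((p ^ (b + 2) : ℕ) : ℚ) + (m : ℚ) * ((p ^ (c + 1) : ℕ) : ℚ) * ((p ^ (b + 2) : ℕ) : ℚ)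
      < ((p ^ (c + 1) : ℕ) : ℚ) * ((bentD p b m : ℕ) : ℚ) := by
    have h1 : bentD p b m * p ^ (b + 2) + m * p ^ (c + 1) * p ^ (b + 2) < p ^ (c + 1) * bentD p b m := by
      have : p ^ (c + 1) * bentD p b m = m * p ^ (c + 1) * p ^ (b + 2) + p ^ (c + 1) * p ^ (b + 1) := by
        rw [bentD]; ring
      rw [this]
      have h2 : bentD p b m * p ^ (b + 2) < p ^ (c + 1) * p ^ (b + 1) := by
        rw [bentD, show (m * p + 1) * p ^ (b + 1) * p ^ (b + 2) = ((m * p + 1) * p ^ (b + 2)) * p ^ (b + 1) by ring]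
        exact Nat.mul_lt_mul_of_pos_right hq (by positivity)
      omega
    exact_mod_cast h1
  have h1 : ((p ^ (c + 1) : ℕ) : ℚ) * ((bentD p b m : ℕ) : ℚ) * ((p ^ (b + 2) : ℕ) : ℚ) * (((p ^ (b + 2) : ℕ) : ℚ))⁻¹
      = ((p ^ (c + 1) : ℕ) : ℚ) * ((bentD p b m : ℕ) : ℚ) := mul_inv_cancel_right₀ hν.ne' _
  have h2 : ((p ^ (c + 1) : ℕ) : ℚ) * ((bentD p b m : ℕ) : ℚ) * ((p ^ (b + 2) : ℕ) : ℚ) *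
      (1 / ((p ^ (c + 1) : ℕ) : ℚ) + (m : ℚ) * (((bentD p b m : ℕ) : ℚ))⁻¹)
      = ((bentD p b m : ℕ) : ℚ) * ((p ^ (b + 2) : ℕ) : ℚ) +
        (m : ℚ) * ((p ^ (c + 1) : ℕ) : ℚ) * ((p ^ (b + 2) : ℕ) : ℚ) := by
    field_simp
  have hle' := mul_le_mul_of_nonneg_left hle (le_of_lt (mul_pos (mul_pos hq' hD) hν))
  rw [h1, h2] at hle'
  linarith

end BentFamily

/-! ## §3 Order, initial form, `δ`, `δ`-face and `τ` of `h` — characteristic-free -/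

section NewtonData

variable {p b m c : ℕ}

/-- `in_ν` of a monomial (plumbing). [folklore] -/
private theorem homogeneousComponent_monomial₄₅ (n : ℕ) (e : Fin 4 →₀ ℕ) :
    homogeneousComponent n (monomial e (1 : k)) = if n = e.degree then monomial e 1 else 0 :=
  homogeneousComponent_of_mem ((mem_homogeneousSubmodule _ _).2 (isHomogeneous_monomial 1 rfl))

/-- **`ord h = p^a`** (all weights `1`): the degrees of the five monomials are `q/p, p^a, D, p^{a−1} + n, D ≥ p^a`.
(derived here) [cite: AbramovichTemkinWlodarczyk2024, Lemma 5.2.10 (p. 1577)] -/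
theorem monomialOrd_one_bentH (hp : 2 ≤ p) (hm : 1 ≤ m) (hq : (m * p + 1) * p ^ (b + 2) < p ^ (c + 1)) :
    monomialOrd (fun _ => 1) (bentH k p b m c) = ((p ^ (b + 2) : ℕ) : ℕ∞) := by
  classical
  apply le_antisymm
  · have h := monomialOrd_le_weight (fun _ : Fin 4 => 1) (F := bentH k p b m c) (d := expFin4 0 (p ^ (b + 2)) 0 0)
      (by rw [mem_support_iff, coeff_e1_bentH₄₅ hp]; exact one_ne_zero)
    rw [weight_expFin4] at h
    simpa using h
  · rw [le_monomialOrd_iff]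
    intro d hd
    have hp1 : 1 ≤ p := by omega
    have hD := nu_lt_bentD₄₅ hp1 hm b
    have hD5 := nu_lt_bentD5₄₅ hp hm b
    have hc := bentD_lt_of_hq₄₅ hq
    have e1 := bentD_eq₄₅ p b m
    have e2 := bentN_add₄₅ hp1 b m
    rcases (by simpa only [Finset.mem_insert, Finset.mem_singleton] using support_bentH_subset p b m c hd :
        d = _ ∨ d = _ ∨ d = _ ∨ d = _ ∨ d = _) with rfl | rfl | rfl | rfl | rfl <;>
      rw [weight_expFin4] <;> simp only [mul_one, zero_add, add_zero] <;> omega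

/-- **`in_{p^a} h = y1^{p^a}`** (so `τ(in h) = 1`, block `S = {y1}`). (derived here)
[cite: CossartJannsenSaito2020, Def. 1.26 / Lemma 1.27] [cite: AbramovichTemkinWlodarczyk2024, Thm. 5.3.1 (2)] -/
theorem homogeneousComponent_bentH (hp : 2 ≤ p) (hm : 1 ≤ m) (hq : (m * p + 1) * p ^ (b + 2) < p ^ (c + 1)) :
    homogeneousComponent (p ^ (b + 2)) (bentH k p b m c) = X 1 ^ p ^ (b + 2) := by
  classical
  have hp1 : 1 ≤ p := by omega
  have hD := nu_lt_bentD₄₅ hp1 hm b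
  have hD5 := nu_lt_bentD5₄₅ hp hm b
  have hc := bentD_lt_of_hq₄₅ hq
  have e1 := bentD_eq₄₅ p b m
  have e2 := bentN_add₄₅ hp1 b m
  have hX : (X 1 ^ p ^ (b + 2) : MvPolynomial (Fin 4) k) = monomial (expFin4 0 (p ^ (b + 2)) 0 0) 1 := by
    rw [monomial_expFin4]; simp
  have H0 : homogeneousComponent (p ^ (b + 2)) (monomial (expFin4 0 0 0 (p ^ c)) (1 : k)) = 0 := by
    rw [homogeneousComponent_monomial₄₅, degree_expFin4, if_neg (by omega)]
  have H1 : homogeneousComponent (p ^ (b + 2)) (monomial (expFin4 0 (p ^ (b + 2)) 0 0) (1 : k)) =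
      monomial (expFin4 0 (p ^ (b + 2)) 0 0) 1 := by
    rw [homogeneousComponent_monomial₄₅, degree_expFin4, if_pos (by omega)]
  have H2 : homogeneousComponent (p ^ (b + 2)) (monomial (expFin4 0 0 (m * p ^ (b + 2)) (p ^ (b + 1))) (1 : k)) = 0 := by
    rw [homogeneousComponent_monomial₄₅, degree_expFin4, if_neg (by omega)]
  have H3 : homogeneousComponent (p ^ (b + 2)) (monomial (expFin4 0 (p ^ (b + 1)) (bentN p b m) 0) (1 : k)) = 0 := by
    rw [homogeneousComponent_monomial₄₅, degree_expFin4, if_neg (by omega)]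
  have H4 : homogeneousComponent (p ^ (b + 2))
      (monomial (expFin4 0 0 (bentN p b m + m * p ^ (b + 1)) (p ^ b)) (1 : k)) = 0 := by
    rw [homogeneousComponent_monomial₄₅, degree_expFin4, if_neg (by omega)]
  rw [bentH_eq_monomial, map_add, map_sub, map_add, map_sub, H0, H1, H2, H3, H4, hX]
  simp

/-- The second vertex monomial `y2^{m p^a} y3^{p^{a−1}}` is in the support (plumbing). [folklore] -/
private theorem e2_mem_support₄₅ (hp : 2 ≤ p) (hq : (m * p + 1) * p ^ (b + 2) < p ^ (c + 1)) :
    expFin4 0 0 (m * p ^ (b + 2)) (p ^ (b + 1)) ∈ (bentH k p b m c).support := by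
  rw [mem_support_iff, coeff_e2_bentH₄₅ hp hq]; norm_num

/-- **`δ(h; x, y2, y3; y1) = D/p^a = (mp+1)/p`**: over the monomials with `y1`-degree `< p^a` the ratio
`|A|/(p^a − |B|)` is `q/(p·p^a) > δ` at `y3^{q/p}`, `= δ` at `y2^{mp^a} y3^{p^{a−1}}`, at `y1^{p^{a−1}} y2^n` and at
`y2^{n+mp^{a−1}} y3^{p^{a−2}}` (three monomials ON the `δ`-face). (derived here)
[cite: CossartJannsenSaito2020, Def. 8.1 (3) / Def. 8.2 (1) (pp. 117–118)] -/
theorem hironakaDelta_bentH (hp : 2 ≤ p) (hq : (m * p + 1) * p ^ (b + 2) < p ^ (c + 1)) :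
    hironakaDelta ({1} : Finset (Fin 4)) (p ^ (b + 2)) (bentH k p b m c) =
      ((((bentD p b m : ℕ) : ℚ) / ((p ^ (b + 2) : ℕ) : ℚ) : ℚ) : WithTop ℚ) := by
  classical
  have hp1 : 1 ≤ p := by omega
  have hc := bentD_lt_of_hq₄₅ hq
  have hsubpos : 0 < p ^ (b + 2) - p ^ (b + 1) := Nat.sub_pos_of_lt (Nat.pow_lt_pow_right (by omega) (by omega))
  apply le_antisymm
  · unfold hironakaDelta
    refine (Finset.inf_le (Finset.mem_filter.2 ⟨e2_mem_support₄₅ hp hq, ?_⟩)).trans (le_of_eq ?_)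
    · rw [blockDeg_one_expFin4]; positivity
    · rw [coDeg_one_expFin4, blockDeg_one_expFin4, Nat.sub_zero, zero_add, ← bentD_eq₄₅]
  · rw [le_hironakaDelta_iff]
    intro d hd hb
    rcases (by simpa only [Finset.mem_insert, Finset.mem_singleton] using support_bentH_subset p b m c hd :
        d = _ ∨ d = _ ∨ d = _ ∨ d = _ ∨ d = _) with rfl | rfl | rfl | rfl | rfl
    · rw [coDeg_one_expFin4, blockDeg_one_expFin4, Nat.sub_zero, zero_add, zero_add]
      exact div_le_div_of_nonneg_right (by exact_mod_cast hc.le) (by positivity)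
    · rw [blockDeg_one_expFin4] at hb
      exact absurd hb (lt_irrefl _)
    · rw [coDeg_one_expFin4, blockDeg_one_expFin4, Nat.sub_zero, zero_add, ← bentD_eq₄₅]
    · rw [coDeg_one_expFin4, blockDeg_one_expFin4, zero_add, add_zero,
        div_le_div_iff₀ (by positivity) (by exact_mod_cast hsubpos)]
      exact le_of_eq (bentN_face₄₅ p b m).symm
    · rw [coDeg_one_expFin4, blockDeg_one_expFin4, Nat.sub_zero, zero_add, bentN_add₄₅ hp1]

/-- **`in_δ h = Φ`**: the `δ`-face of `Δ(h; u; y1)` carries exactly the four monomials of `Φ`; `y3^{q/p}` lies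
strictly above it (`q/p > D`). (derived here) [cite: CossartJannsenSaito2020, Def. 8.2 (4) (p. 118)] -/
theorem deltaInitial_bentH (hp : 2 ≤ p) (hm : 1 ≤ m) (hq : (m * p + 1) * p ^ (b + 2) < p ^ (c + 1)) :
    deltaInitial ({1} : Finset (Fin 4)) (p ^ (b + 2)) (((bentD p b m : ℕ) : ℚ) / ((p ^ (b + 2) : ℕ) : ℚ))
      (bentH k p b m c) = bentFace k p b m := by
  classical
  have hp1 : 1 ≤ p := by omega
  have hc := bentD_lt_of_hq₄₅ hq
  have hD := nu_lt_bentD₄₅ hp1 hm b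
  have hν : ((p ^ (b + 2) : ℕ) : ℚ) ≠ 0 := by positivity
  have hsubpos : 0 < p ^ (b + 2) - p ^ (b + 1) := Nat.sub_pos_of_lt (Nat.pow_lt_pow_right (by omega) (by omega))
  have hν0 : p ^ (b + 2) ≠ 0 := by positivity
  have hc0 : p ^ c ≠ 0 := by positivity
  have hb0 : p ^ b < p ^ (b + 2) := Nat.pow_lt_pow_right (by omega) (by omega)
  have e1 := bentD_eq₄₅ p b m
  have e2 := bentN_add₄₅ hp1 b m
  have hface : bentFace k p b m = bentH k p b m c - monomial (expFin4 0 0 0 (p ^ c)) 1 := by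
    rw [bentH, monomial_expFin4]; simp
  -- the face predicate on the five exponent vectors
  have P1 : blockDeg ({1} : Finset (Fin 4)) (expFin4 0 (p ^ (b + 2)) 0 0) ≤ p ^ (b + 2) ∧
      ((coDeg ({1} : Finset (Fin 4)) (expFin4 0 (p ^ (b + 2)) 0 0) : ℚ) =
        ((bentD p b m : ℕ) : ℚ) / ((p ^ (b + 2) : ℕ) : ℚ) *
          (((p ^ (b + 2) - blockDeg ({1} : Finset (Fin 4)) (expFin4 0 (p ^ (b + 2)) 0 0) : ℕ) : ℚ))) := by
    rw [blockDeg_one_expFin4, coDeg_one_expFin4]; simp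
  have P2 : blockDeg ({1} : Finset (Fin 4)) (expFin4 0 0 (m * p ^ (b + 2)) (p ^ (b + 1))) ≤ p ^ (b + 2) ∧
      ((coDeg ({1} : Finset (Fin 4)) (expFin4 0 0 (m * p ^ (b + 2)) (p ^ (b + 1))) : ℚ) =
        ((bentD p b m : ℕ) : ℚ) / ((p ^ (b + 2) : ℕ) : ℚ) *
          (((p ^ (b + 2) - blockDeg ({1} : Finset (Fin 4)) (expFin4 0 0 (m * p ^ (b + 2)) (p ^ (b + 1))) : ℕ) : ℚ))) := by
    rw [blockDeg_one_expFin4, coDeg_one_expFin4, Nat.sub_zero, div_mul_cancel₀ _ hν, zero_add, ← bentD_eq₄₅]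
    exact ⟨Nat.zero_le _, rfl⟩
  have P3 : blockDeg ({1} : Finset (Fin 4)) (expFin4 0 (p ^ (b + 1)) (bentN p b m) 0) ≤ p ^ (b + 2) ∧
      ((coDeg ({1} : Finset (Fin 4)) (expFin4 0 (p ^ (b + 1)) (bentN p b m) 0) : ℚ) =
        ((bentD p b m : ℕ) : ℚ) / ((p ^ (b + 2) : ℕ) : ℚ) *
          (((p ^ (b + 2) - blockDeg ({1} : Finset (Fin 4)) (expFin4 0 (p ^ (b + 1)) (bentN p b m) 0) : ℕ) : ℚ))) := by
    rw [blockDeg_one_expFin4, coDeg_one_expFin4, zero_add, add_zero, div_mul_eq_mul_div, eq_div_iff hν]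
    exact ⟨(Nat.pow_lt_pow_right (by omega) (by omega)).le, bentN_face₄₅ p b m⟩
  have P4 : blockDeg ({1} : Finset (Fin 4)) (expFin4 0 0 (bentN p b m + m * p ^ (b + 1)) (p ^ b)) ≤ p ^ (b + 2) ∧
      ((coDeg ({1} : Finset (Fin 4)) (expFin4 0 0 (bentN p b m + m * p ^ (b + 1)) (p ^ b)) : ℚ) =
        ((bentD p b m : ℕ) : ℚ) / ((p ^ (b + 2) : ℕ) : ℚ) *
          (((p ^ (b + 2) - blockDeg ({1} : Finset (Fin 4)) (expFin4 0 0 (bentN p b m + m * p ^ (b + 1)) (p ^ b)) : ℕ) : ℚ))) := by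
    rw [blockDeg_one_expFin4, coDeg_one_expFin4, Nat.sub_zero, div_mul_cancel₀ _ hν, zero_add, bentN_add₄₅ hp1]
    exact ⟨Nat.zero_le _, rfl⟩
  have P0 : ¬ (blockDeg ({1} : Finset (Fin 4)) (expFin4 0 0 0 (p ^ c)) ≤ p ^ (b + 2) ∧
      ((coDeg ({1} : Finset (Fin 4)) (expFin4 0 0 0 (p ^ c)) : ℚ) =
        ((bentD p b m : ℕ) : ℚ) / ((p ^ (b + 2) : ℕ) : ℚ) *
          (((p ^ (b + 2) - blockDeg ({1} : Finset (Fin 4)) (expFin4 0 0 0 (p ^ c)) : ℕ) : ℚ)))) := by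
    rw [blockDeg_one_expFin4, coDeg_one_expFin4, Nat.sub_zero, div_mul_cancel₀ _ hν, zero_add, zero_add]
    rintro ⟨-, h⟩
    have : p ^ c = bentD p b m := by exact_mod_cast h
    omega
  ext d
  rw [coeff_deltaInitial, hface, coeff_sub, coeff_monomial]
  by_cases hd : d ∈ (bentH k p b m c).support
  · rcases (by simpa only [Finset.mem_insert, Finset.mem_singleton] using support_bentH_subset p b m c hd :
        d = _ ∨ d = _ ∨ d = _ ∨ d = _ ∨ d = _) with rfl | rfl | rfl | rfl | rfl
    · rw [if_neg P0, if_pos rfl, coeff_bentH, if_pos rfl, if_neg, if_neg, if_neg, if_neg]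
      · norm_num
      all_goals (rw [expFin4_eq_iff]; omega)
    · rw [if_pos P1, if_neg, sub_zero]
      rw [expFin4_eq_iff]; omega
    · rw [if_pos P2, if_neg, sub_zero]
      rw [expFin4_eq_iff]; omega
    · rw [if_pos P3, if_neg, sub_zero]
      rw [expFin4_eq_iff]; omega
    · rw [if_pos P4, if_neg, sub_zero]
      rw [expFin4_eq_iff]; omega
  · have h0 : coeff d (bentH k p b m c) = 0 := by rwa [mem_support_iff, not_not] at hd
    rw [h0, ite_self, if_neg, sub_zero]
    rintro rfl
    exact hd (mem_support_iff.2 (by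
      rw [coeff_bentH, if_pos rfl, if_neg, if_neg, if_neg, if_neg]
      · norm_num
      all_goals (rw [expFin4_eq_iff]; omega)))

/-- The support of `Φ` (plumbing). [folklore] -/
private theorem support_bentFace_subset₄₅ (p b m : ℕ) : (bentFace k p b m).support ⊆
    {expFin4 0 (p ^ (b + 2)) 0 0, expFin4 0 0 (m * p ^ (b + 2)) (p ^ (b + 1)),
      expFin4 0 (p ^ (b + 1)) (bentN p b m) 0, expFin4 0 0 (bentN p b m + m * p ^ (b + 1)) (p ^ b)} := by
  classical
  have h : bentFace k p b m = monomial (expFin4 0 (p ^ (b + 2)) 0 0) 1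
      - monomial (expFin4 0 0 (m * p ^ (b + 2)) (p ^ (b + 1))) 1
      + monomial (expFin4 0 (p ^ (b + 1)) (bentN p b m) 0) 1
      - monomial (expFin4 0 0 (bentN p b m + m * p ^ (b + 1)) (p ^ b)) 1 := by
    simp only [bentFace, monomial_expFin4, pow_zero, one_mul, mul_one]
  intro d hd
  simp only [Finset.mem_insert, Finset.mem_singleton]
  by_contra hne
  simp only [not_or] at hne
  obtain ⟨h1, h2, h3, h4⟩ := hne
  rw [h, mem_support_iff] at hd
  simp only [coeff_add, coeff_sub, coeff_monomial, if_neg (Ne.symm h1), if_neg (Ne.symm h2), if_neg (Ne.symm h3),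
    if_neg (Ne.symm h4)] at hd
  simp at hd

/-- `Φ ∈ k[y1, y2, y3]` (plumbing). [folklore] -/
private theorem vars_bentFace_subset₄₅ (p b m : ℕ) : (bentFace k p b m).vars ⊆ {1, 2, 3} := by
  classical
  intro x hx
  obtain ⟨d, hd, hxd⟩ := (mem_vars_iff_mem_support x).1 hx
  have hx0 : d x ≠ 0 := Finsupp.mem_support_iff.1 hxd
  have hd' := support_bentFace_subset₄₅ p b m hd
  simp only [Finset.mem_insert, Finset.mem_singleton] at hd' ⊢
  have hx' : x ≠ 0 := by
    rintro rfl
    rcases hd' with rfl | rfl | rfl | rfl <;> simp at hx0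
  clear hx hd hxd hx0 hd'
  revert hx'
  decide +revert

/-- Coefficient bookkeeping in `k[T]` (plumbing): `(aT)^j = a^j T^j`. [folklore] -/
private theorem C_mul_T_pow₄₅ (a : k) (j : ℕ) :
    (Polynomial.C a * Polynomial.X : Polynomial k) ^ j = Polynomial.C (a ^ j) * Polynomial.X ^ j := by
  rw [mul_pow, Polynomial.C_pow]

/-- **`τ(Φ) = 3`: the `δ`-face form involves all of `y1, y2, y3` essentially** — its invariance space
(translations `w` with `Φ(Y + T w) = Φ(Y)` identically) is `w₁ = w₂ = w₃ = 0`: the coefficient of `T^{p^a}` in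
`Φ(Tw)` is `w₁^{p^a}`; given `w₁ = 0`, the coefficient of `T^{mp^a}` in `Φ((0,0,0,1) + Tw)` is `−w₂^{mp^a}`; given
`w₁ = w₂ = 0`, the coefficient of `T^{p^{a−2}}` in `Φ((0,0,1,0) + Tw)` is `−w₃^{p^{a−2}}` (identities in `k[T]`,
valid over every field, finite ones included). (derived here) [cite: CossartJannsenSaito2020, Def. 1.26 / Lemma 1.27
and Thm. 8.16 (p. 121) (`τ` of the `δ`-initial form)] -/
theorem hironakaTau_bentFace (hp : 2 ≤ p) (hm : 1 ≤ m) (b : ℕ) : hironakaTau k {bentFace k p b m} = 3 := by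
  classical
  have hp1 : 1 ≤ p := by omega
  have hD := nu_lt_bentD₄₅ hp1 hm b
  have hD5 := nu_lt_bentD5₄₅ hp hm b
  have e1 := bentD_eq₄₅ p b m
  have e2 := bentN_add₄₅ hp1 b m
  have hbb : p ^ b < p ^ (b + 1) := Nat.pow_lt_pow_right (by omega) (by omega)
  have hb1 : p ^ (b + 1) < p ^ (b + 2) := Nat.pow_lt_pow_right (by omega) (by omega)
  have hν0 : p ^ (b + 2) ≠ 0 := by positivity
  rw [show (3 : ℕ) = ({1, 2, 3} : Finset (Fin 4)).card by rfl]
  refine hironakaTau_singleton_eq_card (vars_bentFace_subset₄₅ p b m) fun w hw => ?_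
  -- the invariance identity at `k[T]`-valued points
  have key : ∀ (y : Fin 4 → Polynomial k),
      aeval (fun x => y x + Polynomial.C (w x) * Polynomial.X) (bentFace k p b m) =
        aeval y (bentFace k p b m) := fun y => by
    have h := aeval_algebra_eq_of_mem_invarianceSpace (A := Polynomial k) hw y Polynomial.X
    simpa only [Polynomial.algebraMap_eq] using h
  have hn0 : bentN p b m + m * p ^ (b + 1) ≠ 0 := by omega
  -- Step 1: `w 1 = 0`, from the point `y = 0`, coefficient of `T^{p^a}`
  have hw1 : w 1 = 0 := by
    have h := congrArg (fun P => Polynomial.coeff P (p ^ (b + 2))) (key 0)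
    simp only [bentFace, map_add, map_sub, map_mul, map_pow, aeval_X, Pi.zero_apply, zero_add,
      zero_pow hν0, zero_pow (show m * p ^ (b + 2) ≠ 0 by positivity),
      zero_pow (show p ^ (b + 1) ≠ 0 by positivity), zero_pow hn0, zero_mul, sub_zero, add_zero,
      Polynomial.coeff_zero] at h
    simp only [C_mul_T_pow₄₅] at h
    rw [mul_mul_mul_comm, ← Polynomial.C_mul, ← pow_add, mul_mul_mul_comm, ← Polynomial.C_mul, ← pow_add,
      mul_mul_mul_comm, ← Polynomial.C_mul, ← pow_add, Polynomial.coeff_sub, Polynomial.coeff_add,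
      Polynomial.coeff_sub, Polynomial.coeff_C_mul_X_pow, Polynomial.coeff_C_mul_X_pow,
      Polynomial.coeff_C_mul_X_pow, Polynomial.coeff_C_mul_X_pow, if_pos rfl, if_neg (by omega),
      if_neg (by omega), if_neg (by omega), sub_zero, add_zero, sub_zero] at h
    exact pow_eq_zero_iff hν0 |>.1 h
  -- Step 2: `w 2 = 0`, from the point `y = (0,0,0,1)`, coefficient of `T^{m p^a}`
  have hw2 : w 2 = 0 := by
    have h := congrArg (fun P => Polynomial.coeff P (m * p ^ (b + 2))) (key (fun x => if x = 3 then 1 else 0))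
    simp only [bentFace, map_add, map_sub, map_mul, map_pow, aeval_X, hw1, map_zero, zero_mul,
      show (1 : Fin 4) ≠ 3 by decide, show (2 : Fin 4) ≠ 3 by decide, if_true, if_false,
      zero_add, add_zero, zero_pow hν0, zero_pow (show p ^ (b + 1) ≠ 0 by positivity),
      zero_pow (show m * p ^ (b + 2) ≠ 0 by positivity), zero_pow hn0, one_pow, mul_one, sub_zero,
      zero_sub, Polynomial.coeff_zero, Polynomial.coeff_sub, Polynomial.coeff_neg] at h
    simp only [C_mul_T_pow₄₅] at h
    rw [mul_assoc, Polynomial.coeff_C_mul, Polynomial.coeff_X_pow_mul', if_pos le_rfl, Nat.sub_self,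
      Polynomial.coeff_zero_eq_eval_zero, mul_assoc, Polynomial.coeff_C_mul, Polynomial.coeff_X_pow_mul',
      if_neg (by omega)] at h
    simp only [Polynomial.eval_pow, Polynomial.eval_add, Polynomial.eval_one, Polynomial.eval_mul,
      Polynomial.eval_C, Polynomial.eval_X, mul_zero, add_zero, one_pow, mul_one, sub_zero, neg_eq_zero] at h
    exact pow_eq_zero_iff (by positivity) |>.1 h
  -- Step 3: `w 3 = 0`, from the point `y = (0,0,1,0)`, coefficient of `T^{p^{a−2}}`
  have hw3 : w 3 = 0 := by
    have h := congrArg (fun P => Polynomial.coeff P (p ^ b)) (key (fun x => if x = 2 then 1 else 0))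
    simp only [bentFace, map_add, map_sub, map_mul, map_pow, aeval_X, hw1, hw2, map_zero, zero_mul,
      show (1 : Fin 4) ≠ 2 by decide, show (3 : Fin 4) ≠ 2 by decide, if_true, if_false,
      zero_add, add_zero, zero_pow hν0, zero_pow (show p ^ (b + 1) ≠ 0 by positivity),
      zero_pow (show p ^ b ≠ 0 by positivity), one_pow, one_mul, mul_one, mul_zero, zero_sub, sub_zero,
      Polynomial.coeff_zero, Polynomial.coeff_sub, Polynomial.coeff_neg] at h
    simp only [C_mul_T_pow₄₅, Polynomial.coeff_C_mul_X_pow, if_neg (show ¬ p ^ b = p ^ (b + 1) by omega),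
      if_true, neg_zero, zero_sub, neg_eq_zero] at h
    exact pow_eq_zero_iff (by positivity) |>.1 h
  intro x hx
  simp only [Finset.mem_insert, Finset.mem_singleton] at hx
  rcases hx with rfl | rfl | rfl
  exacts [hw1, hw2, hw3]

end NewtonData

/-! ## §4 `max W(F) = (p^a, D, D)` -/

section Max

variable {p b m c : ℕ}

/-- **`max W(h_{p,a,m}) = (p^a, (mp+1)p^{a−1}, (mp+1)p^{a−1})` over EVERY field** (`p ≥ 2` any integer, `m ≥ 1`,
`q/p = p^c > (mp+1)p^{a−1}`): order `p^a` with `in = y1^{p^a}`, `δ = (mp+1)/p ∉ ℕ`, `τ(in_δ) = 3`, and the identity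
centre with `γ = (0; p^{−a}, 1/D, 1/D)` attains it. (derived here — the `(ν, M, M)` pattern of §0; the cell's
LEMMA C_m / Theorem 2 value `C_q(h) = c*`, here for centres presented by polynomial coordinate changes)
[cite: CossartJannsenSaito2020, Thm. 8.16 (p. 121), Thm. 8.22 (a) (p. 124)]
[cite: AbramovichTemkinWlodarczyk2024, Thm. 5.3.1 (2)–(3) (p. 1578)] -/
theorem isMaxInv_bentH (hp : 2 ≤ p) (hm : 1 ≤ m) (hq : (m * p + 1) * p ^ (b + 2) < p ^ (c + 1)) :
    IsMaxInv (admissibleInvariants (bentH k p b m c))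
      [((p ^ (b + 2) : ℕ) : ℚ), ((bentD p b m : ℕ) : ℚ), ((bentD p b m : ℕ) : ℚ)] :=
  isMaxInv_triple_of_forall_natCast_ne (monomialOrd_one_bentH hp hm hq) (homogeneousComponent_bentH hp hm hq)
    (by positivity) (by exact_mod_cast nu_lt_bentD₄₅ (p := p) (by omega) hm b) (hironakaDelta_bentH hp hq)
    (natCast_ne_bentDelta₄₅ hp b m) (by rw [deltaInitial_bentH hp hm hq, hironakaTau_bentFace hp hm])
    (bentH_mem_admissibleInvariants hp hm hq)

/-- **THE BENT FAMILY: `max W(x^q + h_{p,a,m}) = (p^a, (mp+1)p^{a−1}, (mp+1)p^{a−1})`** in characteristic `p`, for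
every prime `p`, `a = b + 2 ≥ 2`, `m ≥ 1`, `q = p^{c+1} > p^a(mp+1)`, over admissible centres presented by polynomial
coordinate changes — attained by the NON-SPLIT bent centre `(y1 + x y2^m, y2, y3 + x^p; p^{−a}, 1/D, 1/D; x free)`,
which is NOT `T`-tight (`not_isTTight_bent`).  (derived here; the cell's Theorems 1(a) + 2 in the polynomial model;
that NO maximal centre is `T`-tight — the cell's Theorem 1(b) — is NOT typed here.)  Instrument value, not a
resolution statement. [cite: AbramovichTemkinWlodarczyk2024, Thm. 5.3.1 (2)–(3) (p. 1578)]
[cite: Hauser2010, §C (p. 9), §D (p. 12) (wild purely inseparable singularities; kangaroo points)]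
[cite: CossartJannsenSaito2020, Thm. 8.16 (p. 121)] -/
theorem isMaxInv_bentF [hp : Fact p.Prime] [CharP k p] (hm : 1 ≤ m) (hq : (m * p + 1) * p ^ (b + 2) < p ^ (c + 1)) :
    IsMaxInv (admissibleInvariants (bentF k p b m c))
      [((p ^ (b + 2) : ℕ) : ℚ), ((bentD p b m : ℕ) : ℚ), ((bentD p b m : ℕ) : ℚ)] := by
  rw [admissibleInvariants_bentF]
  exact isMaxInv_bentH hp.out.two_le hm hq

/-- The same with the exponent `a ≥ 2` of the statement (`a = b + 2`): **`max W(x^{p^{c+1}} + h_{p,a,m}) =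
(p^a, (mp+1)p^{a−1}, (mp+1)p^{a−1})`**. (derived here) [cite: AbramovichTemkinWlodarczyk2024, Thm. 5.3.1 (2)–(3)] -/
theorem isMaxInv_bentF' [hp : Fact p.Prime] [CharP k p] {a : ℕ} (ha : 2 ≤ a) (hm : 1 ≤ m)
    (hq : (m * p + 1) * p ^ a < p ^ (c + 1)) :
    IsMaxInv (admissibleInvariants (bentF k p (a - 2) m c))
      [((p ^ a : ℕ) : ℚ), (((m * p + 1) * p ^ (a - 1) : ℕ) : ℚ), (((m * p + 1) * p ^ (a - 1) : ℕ) : ℚ)] := by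
  obtain ⟨b, rfl⟩ : ∃ b, a = b + 2 := ⟨a - 2, by omega⟩
  have h := isMaxInv_bentF (k := k) hm hq
  rw [bentD] at h
  rw [show b + 2 - 2 = b from rfl, show b + 2 - 1 = b + 1 from rfl]
  exact h

/-- **The smallest instance** `(p, a, m, q) = (2, 2, 1, 16)`: over any field of characteristic `2`,
`max W(x^16 + y3^8 + y1^4 + y2^4 y3^2 + y1^2 y2^3 + y2^5 y3) = (4, 6, 6)` (signs are immaterial in characteristic `2`),
attained by the bent centre `(y1 + x y2, y2, y3 + x²; 1/4, 1/6, 1/6)`. (derived here; found by the cell's `S⁺`-census,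
engine-1 gen 27, certified by two engines, gen 28) [cite: AbramovichTemkinWlodarczyk2024, Thm. 5.3.1 (2)–(3) (p. 1578)]
[cite: Hauser2010, §D (p. 12)] -/
theorem isMaxInv_bent_2_2_1_16 (k : Type*) [Field k] [CharP k 2] :
    IsMaxInv (admissibleInvariants
      (X 0 ^ 16 + (X 3 ^ 8 + (X 1 ^ 4 - X 2 ^ 4 * X 3 ^ 2 + X 1 ^ 2 * X 2 ^ 3 - X 2 ^ 5 * X 3)) :
        MvPolynomial (Fin 4) k)) [(4 : ℚ), 6, 6] := by
  haveI : Fact (Nat.Prime 2) := ⟨Nat.prime_two⟩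
  have h := isMaxInv_bentF (k := k) (p := 2) (b := 0) (m := 1) (c := 3) le_rfl (by norm_num)
  simp only [bentF, bentH, bentFace, bentN, bentD] at h
  norm_num at h
  exact h

end Max

end Literature.AlgebraicGeometry.Resolution.WeightedBlowup
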